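import Mathlib
import Literature.NumberTheory.Sieve.VinogradovExpSumTools
import HarnessLib

/-!
# Teräväinen 2024, §5.3: differencing over a cube kills the other phases ((5.27) ⇒ (5.28))

Support file (everything PROVED; no definitions, no named facts) towards the named fact
`Literature.NumberTheory.Sieve.teravainen2024_cor_2_1` (J. Teräväinen, *On the Liouville function
at polynomial arguments*, Amer. J. Math. 146 (2024) = arXiv:2010.07924, Corollary 2.1 ⊂
Theorem 2.6 for `g_j = λ`, proved in §5). In the proof of Proposition 5.3 (§5.3, p. 12) one has,
off an exceptional set, `‖∑_{j=1}^k F_j(L_j(𝐱 + v_1ℓ_1 + ⋯ + v_kℓ_k)) - α‖ ≪ η^{1/4}` for all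
`v ∈ {0,1}^k` ((5.27)), and

> "Hence, utilizing (5.27), the triangle inequality for `‖·‖`, and the fact that `L_1` is
> independent of `x_1`, we see that [the iterated difference]
> `‖∂^{(2)}_{ℓ_2} ⋯ ∂^{(k)}_{ℓ_k} F_1(L_1(0, x_2, …, x_k))‖ ≪ η^{1/4}`" ((5.28)),

the point being that the alternating sum over the cube `{0,1}^{{2,…,k}}` of
`∑_j F_j(L_j(·)) - α` kills `α` and every `F_j(L_j(·))` with `j ≥ 2` (as `L_j` does not depend on
the `j`-th coordinate), leaving the iterated difference of `F_1 ∘ L_1`. This file proves that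
mechanism abstractly, with the cube `{0,1}^J` realised as the power set of a finite set `J`:

* `Teravainen2024.sum_powerset_negOnePow_eq_zero_of_indep` — if `A : Finset ι → M` satisfies
  `A (insert j T) = A T` for all `T` (independence of the coordinate `j ∈ J`), then
  `∑_{T ⊆ J} (-1)^{|T|} A T = 0`;
* `Teravainen2024.distInt_sum_le`, `distInt_signedSum_le` — `‖·‖_{ℝ/ℤ}` is subadditive over
  (signed) finite sums;
* `Teravainen2024.distInt_signedSum_le_sum_of_decomp` — **the mechanism**: if
  `H T = B T + ∑_{j ∈ J} A_j T + α` with each `A_j` independent of the coordinate `j` and `J ≠ ∅`,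
  then `‖∑_{T ⊆ J} (-1)^{|T|} B T‖_{ℝ/ℤ} ≤ ∑_{T ⊆ J} ‖H T‖_{ℝ/ℤ}`.

## References
* J. Teräväinen, Amer. J. Math. 146 (2024), §5.3, proof of Proposition 5.3, (5.27)–(5.28)
  (p. 12), arXiv:2010.07924. [Teravainen2024]
-/

noncomputable section

open Finset

namespace Literature.NumberTheory.Sieve

namespace Teravainen2024

open Literature.NumberTheory.Sieve.Vinogradov

variable {ι : Type*} [DecidableEq ι]

/-- **Independence of one coordinate kills the alternating cube sum.** If `j ∈ J` and
`A (insert j T) = A T` for every `T ⊆ J ∖ {j}`, then `∑_{T ⊆ J} (-1)^{|T|} A(T) = 0`.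
[cite: Teravainen2024, §5.3, (5.27) ⇒ (5.28) ("L_j is independent of the jth coordinate")] -/
theorem sum_powerset_negOnePow_eq_zero_of_indep {M : Type*} [AddCommGroup M] {J : Finset ι} {j : ι}
    (hj : j ∈ J) (A : Finset ι → M) (hA : ∀ T, T ⊆ J.erase j → A (insert j T) = A T) :
    ∑ T ∈ J.powerset, ((-1 : ℤ) ^ #T) • A T = 0 := by
  have hJ : J = insert j (J.erase j) := (Finset.insert_erase hj).symm
  rw [hJ, Finset.sum_powerset_insert (Finset.notMem_erase j J), ← Finset.sum_add_distrib]
  refine Finset.sum_eq_zero fun T hT => ?_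
  rw [Finset.mem_powerset] at hT
  have hjT : j ∉ T := fun h => Finset.notMem_erase j J (hT h)
  rw [Finset.card_insert_of_notMem hjT, hA T hT, pow_succ]
  simp

omit [DecidableEq ι] in
/-- The alternating sum of a constant over a nonempty cube vanishes. [folklore] -/
theorem sum_powerset_negOnePow_smul_const {M : Type*} [AddCommGroup M] {J : Finset ι}
    (hJ : J.Nonempty) (c : M) : ∑ T ∈ J.powerset, ((-1 : ℤ) ^ #T) • c = 0 := by
  rw [← Finset.sum_smul, Finset.sum_powerset_neg_one_pow_card_of_nonempty hJ, zero_smul]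

/-- `‖·‖_{ℝ/ℤ}` is subadditive over finite sums. [folklore] -/
theorem distInt_sum_le {κ : Type*} (S : Finset κ) (y : κ → ℝ) :
    distInt (∑ s ∈ S, y s) ≤ ∑ s ∈ S, distInt (y s) := by
  classical
  induction S using Finset.induction_on with
  | empty => simp [distInt_zero]
  | insert a S ha ih =>
    rw [Finset.sum_insert ha, Finset.sum_insert ha]
    exact (distInt_add_le _ _).trans (add_le_add le_rfl ih)

omit [DecidableEq ι] in
/-- `‖·‖_{ℝ/ℤ}` of a signed sum: `‖∑ (-1)^{|T|} y_T‖ ≤ ∑ ‖y_T‖`. [folklore] -/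
theorem distInt_signedSum_le (J : Finset ι) (y : Finset ι → ℝ) :
    distInt (∑ T ∈ J.powerset, ((-1 : ℤ) ^ #T) • y T) ≤ ∑ T ∈ J.powerset, distInt (y T) := by
  refine (distInt_sum_le _ _).trans (Finset.sum_le_sum fun T _ => ?_)
  rcases neg_one_pow_eq_or ℤ #T with h | h
  · rw [h, one_smul]
  · rw [h, neg_smul, one_smul, distInt_neg]

/-- **The differencing mechanism of (5.27) ⇒ (5.28).** Let `J` be a nonempty finite set of
directions and, for `T ⊆ J` (a vertex of the cube `{0,1}^J`), `H T = B T + ∑_{j∈J} A_j T + α`,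
where each `A_j` is independent of the coordinate `j` (`A_j (insert j T) = A_j T`). Then
`‖∑_{T ⊆ J} (-1)^{|T|} B T‖_{ℝ/ℤ} ≤ ∑_{T ⊆ J} ‖H T‖_{ℝ/ℤ}`.
[cite: Teravainen2024, §5.3, (5.27) ⇒ (5.28) (p. 12)] -/
theorem distInt_signedSum_le_sum_of_decomp {J : Finset ι} (hJ : J.Nonempty) (B : Finset ι → ℝ)
    (A : ι → Finset ι → ℝ) (α : ℝ) (H : Finset ι → ℝ)
    (hH : ∀ T, T ⊆ J → H T = B T + ∑ j ∈ J, A j T + α)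
    (hA : ∀ j ∈ J, ∀ T, T ⊆ J.erase j → A j (insert j T) = A j T) :
    distInt (∑ T ∈ J.powerset, ((-1 : ℤ) ^ #T) • B T) ≤ ∑ T ∈ J.powerset, distInt (H T) := by
  -- the alternating sum of `H` equals that of `B`
  have hkill : ∑ T ∈ J.powerset, ((-1 : ℤ) ^ #T) • H T = ∑ T ∈ J.powerset, ((-1 : ℤ) ^ #T) • B T := by
    have h1 : ∑ T ∈ J.powerset, ((-1 : ℤ) ^ #T) • H T =
        ∑ T ∈ J.powerset, (((-1 : ℤ) ^ #T) • B T + ((-1 : ℤ) ^ #T) • (∑ j ∈ J, A j T) + ((-1 : ℤ) ^ #T) • α) := by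
      refine Finset.sum_congr rfl fun T hT => ?_
      rw [hH T (Finset.mem_powerset.mp hT), smul_add, smul_add]
    rw [h1, Finset.sum_add_distrib, Finset.sum_add_distrib, sum_powerset_negOnePow_smul_const hJ α,
      add_zero]
    have h2 : ∑ T ∈ J.powerset, ((-1 : ℤ) ^ #T) • (∑ j ∈ J, A j T) = 0 := by
      rw [show (∑ T ∈ J.powerset, ((-1 : ℤ) ^ #T) • ∑ j ∈ J, A j T) =
          ∑ j ∈ J, ∑ T ∈ J.powerset, ((-1 : ℤ) ^ #T) • A j T by
        simp_rw [Finset.smul_sum]; exact Finset.sum_comm]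
      exact Finset.sum_eq_zero fun j hj => sum_powerset_negOnePow_eq_zero_of_indep hj (A j) (hA j hj)
    rw [h2, add_zero]
  rw [← hkill]
  exact distInt_signedSum_le J H

end Teravainen2024

end Literature.NumberTheory.Sieve
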